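import Summits.ValiantsHypothesis.ValiantsHypothesis.Theorems.LacunarySymmetroidMatrixDescartesWLawBlockSum

/-!
# `MatrixDescartes` (stmt-ValiantsHypothesis-18050) — the W-rows are MONOTONE IN THE SIZE
# (padding = block sum with a root-free `1 × 1` piece, any support)

HONEST FRAMING.  Cell `pub-symmetroid`, seat `val-sym-mdr-p2` (gen 7); helper `--supports` the crux
`Theses.LacunarySymmetroid.MatrixDescartes` (OPEN), NO closure claim.  Bookkeeping corollary of the block-sum lemma
`WLawBlockSum.superadditive`: a valid W-budget at a larger size is a valid budget at every smaller size, because any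
configuration can be padded by a root-free piece (zero letters; the lemma replaces a vanishing determinant by `(0, 0, 0, 1)`)
ON ITS OWN SUPPORT — the common-support restriction of the superadditivity lemma is harmless here since the padding piece exists
on every support.  Hence `w(n) := min {B | WLawAt n B}` is non-decreasing in `n`; in particular `¬ WLawAt n 9` for every
`n ≥ 3`.  (The pivot-row analogue is already the tree's `Pivot.pivotRootLawAt_of_le_size` of `…CensusPivotNormalForm` and is not
restated.)  Nothing here bears on the crux in its window, `DoorA26` / `DoorA34`, the registers, or `VP ≠ VNP`.

[folklore] Elementary; tree inputs `WLawBlockSum.superadditive`, `not_wLawAt_three_nine`.  Axioms `propext`,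
`Classical.choice`, `Quot.sound`.
-/

-- `Summit.ValiantsHypothesis.ValiantsHypothesis.…` repeats a component by the single-conjunct
-- summit layout, which the `dupNamespace` linter flags; the name is mandated.
set_option linter.dupNamespace false

namespace Summit.ValiantsHypothesis.ValiantsHypothesis.Theorems.LacunarySymmetroidMatrixDescartes

open scoped BigOperators Matrix
open Polynomial

/-- **The W-rows are antitone in the size**: `WLawAt (n + j) B → WLawAt n B` (pad any `n × n` W-configuration with `j`
root-free `1 × 1` pieces on its own support). [folklore] -/
theorem wLawAt_of_add {n j B : ℕ} (h : WLawAt (n + j) B) : WLawAt n B := by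
  intro e d₁ d₂ d₃ J P₁ P₂ Q hJ hP₁ hP₂ hQ h₂₁ h₁e he₃
  -- the given configuration attains its own count `Z`; the empty-count piece of size `j` attains `0`
  have ha : ∃ (J' P₁' P₂' Q' : Matrix (Fin n) (Fin n) ℝ), J'.IsSymm ∧ P₁'.PosSemidef ∧ P₂'.PosSemidef ∧ Q'.PosSemidef ∧
      ((Matrix.det (((X : ℝ[X]) ^ e) • J.map Polynomial.C + ((X : ℝ[X]) ^ d₁) • P₁.map Polynomial.C
        + ((X : ℝ[X]) ^ d₂) • P₂.map Polynomial.C + ((X : ℝ[X]) ^ d₃) • Q.map Polynomial.C)).roots.toFinset.filter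
          (fun t => 0 < t)).card
      ≤ ((Matrix.det (((X : ℝ[X]) ^ e) • J'.map Polynomial.C + ((X : ℝ[X]) ^ d₁) • P₁'.map Polynomial.C
        + ((X : ℝ[X]) ^ d₂) • P₂'.map Polynomial.C + ((X : ℝ[X]) ^ d₃) • Q'.map Polynomial.C)).roots.toFinset.filter
          (fun t => 0 < t)).card :=
    ⟨J, P₁, P₂, Q, hJ, hP₁, hP₂, hQ, le_rfl⟩
  have hb : ∃ (J' P₁' P₂' Q' : Matrix (Fin j) (Fin j) ℝ), J'.IsSymm ∧ P₁'.PosSemidef ∧ P₂'.PosSemidef ∧ Q'.PosSemidef ∧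
      0 ≤ ((Matrix.det (((X : ℝ[X]) ^ e) • J'.map Polynomial.C + ((X : ℝ[X]) ^ d₁) • P₁'.map Polynomial.C
        + ((X : ℝ[X]) ^ d₂) • P₂'.map Polynomial.C + ((X : ℝ[X]) ^ d₃) • Q'.map Polynomial.C)).roots.toFinset.filter
          (fun t => 0 < t)).card :=
    ⟨0, 0, 0, 0, Matrix.isSymm_zero, Matrix.PosSemidef.zero, Matrix.PosSemidef.zero, Matrix.PosSemidef.zero,
      Nat.zero_le _⟩
  obtain ⟨J', P₁', P₂', Q', hJ', hP₁', hP₂', hQ', hle⟩ := WLawBlockSum.superadditive e d₁ d₂ d₃ ha hb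
  rw [Nat.add_zero] at hle
  exact hle.trans (h e d₁ d₂ d₃ J' P₁' P₂' Q' hJ' hP₁' hP₂' hQ' h₂₁ h₁e he₃)

/-- Equivalently `WLawAt n' B → n ≤ n' → WLawAt n B`. [bookkeeping] -/
theorem wLawAt_of_le {n n' B : ℕ} (hn : n ≤ n') (h : WLawAt n' B) : WLawAt n B := by
  obtain ⟨j, rfl⟩ := Nat.exists_eq_add_of_le hn
  exact wLawAt_of_add h

/-- Row failures propagate UP in the size: `¬ WLawAt n B → n ≤ n' → ¬ WLawAt n' B`. [bookkeeping] -/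
theorem not_wLawAt_of_le {n n' B : ℕ} (hn : n ≤ n') (h : ¬ WLawAt n B) : ¬ WLawAt n' B :=
  fun h' => h (wLawAt_of_le hn h')

/-- In particular `¬ WLawAt n 9` for every `n ≥ 3` (from `not_wLawAt_three_nine`). [bookkeeping] -/
theorem not_wLawAt_nine_of_three_le {n : ℕ} (hn : 3 ≤ n) : ¬ WLawAt n 9 :=
  not_wLawAt_of_le hn not_wLawAt_three_nine

end Summit.ValiantsHypothesis.ValiantsHypothesis.Theorems.LacunarySymmetroidMatrixDescartes
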